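import Literature.NumberTheory.PAdicHodge.AinfWeierstrassDivisionSaturation
import Literature.NumberTheory.PAdicHodge.AinfRamifiedTateModule
import HarnessLib

/-!
# The CM-fibre transport: `[p]_{W_D} ≡ [p]_{E₀} (mod ϖ)` on `Ŵ(𝔪_{ℂ_F})` for a ramified good model `W_D ≡ E₀ (mod ϖ)`, so that
# every `[p]_{W_D}`-division sequence has a unique EXACT `[p]_{E₀}`-SATURATION at distance `≤ ‖ϖ‖`

Topic `Literature/NumberTheory/PAdicHodge` (theorems only; no definition, no named fact, no instance, no `sorry`). Sequel of
`FormalGroupDivisionSaturation` / `AinfWeierstrassDivisionSaturation`. Setting: `F` a `p`-adic field, `D` an Eisenstein datum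
(`𝒪_D = ℤ_p[ϖ]`, the tree's `EisensteinRoot`, discrete coefficient ring `CoeffDisc D` acting on `𝒪_{ℂ_F}`), `W_D` a Weierstrass
equation over `𝒪_D` (the good `𝒪_L`-model of a K★ cell) and `E₀/ℤ` an integral Weierstrass equation (the CM fibre) with THE SAME
REDUCTION MODULO `ϖ`: `W_D ⊗ (𝒪_D/ϖ) = (E₀ ⊗ 𝒪_D) ⊗ (𝒪_D/ϖ)`.

* §1 `coe_ramified_mulPC_map_int` — `[p]_{E₀ ⊗ 𝒪_D} = [p]_{E₀}` on `Ŵ(𝔪_ℂ)` (`AinfRamTop.mulPC (E₀.map _) = AinfTop.mulPC F p E₀`,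
  change of coefficients in the evaluation);
* §2 `exists_formalMul_sub_eq_C_mul_of_map_eq` — `[p]_{W₁} − [p]_{W₂} ∈ ϖ·𝒪_D⟦X⟧` when `W₁ ≡ W₂ (mod ϖ)` (functoriality of `[p]`,
  `WeierstrassCurve.map_formalMul`); `norm_ramified_mulPC_sub_le` — hence **`‖[p]_{W₁}(t) − [p]_{W₂}(t)‖ ≤ ‖ϖ‖`** for every `t ∈ 𝔪_ℂ`;
* §3 ★★ `norm_mulPC_int_sub_le_of_divisionSeq` — every exact `[p]_{W_D}`-division sequence `v` of `Ŵ_D(𝔪_ℂ)` is an APPROXIMATE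
  `[p]_{E₀}`-division sequence: `‖[p]_{E₀}(v_{n+1}) − v_n‖ ≤ ‖ϖ‖`; ★★★ `exists_unique_int_divisionSeq_of_ramified` — hence it has a UNIQUE
  exact `[p]_{E₀}`-division sequence `w` with `‖w_n − v_n‖ ≤ ‖ϖ‖` (its **CM-fibre transport**), by the saturation theorem (`‖ϖ‖ < 1`).

Purpose (line `kato_lever`, crux K★ `stmt-BirchSwinnertonDyer-22226`, memo `Lines/kato-lever-K2-ramified-cm-transport.md`): the K★ cells
are additive of Kodaira type IV*, III*, II* at `p ∈ {5, 7}`; over `L = ℚ_p(p^{1/e})` (`e = 3, 4, 6`) the minimal model becomes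
`y² = x³ + (a₄/p³)ϖ·x + a₆/p⁴`, `y² = x³ + (a₄/p³)·x + (a₆/p⁵)ϖ²`, `y² = x³ + (a₄/p⁴)ϖ⁴·x + a₆/p⁵`, congruent mod `ϖ` to the `ℤ`-CURVES
`E₀ : y² = x³ + a₆/p⁴`, `y² = x³ + (a₄/p³)x`, `y² = x³ + a₆/p⁵` of good reduction at `p`. The transport `v ↦ w` (additive and
`Γ_F`-equivariant by `AinfWeierstrassDivisionSaturation`) carries the Tate module and the Kummer towers of `W_D` into EXACT `[p]_{E₀}`-towers,
to which the unramified φ-road (`BmaxPlusFormalLogDivisionTower`, Honda relation for `E₀`, `BmaxPlusFormalLogKTwo`) applies verbatim.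
BSD / K★ are not proved by any of this; nothing about elliptic curves over number fields is proved here.

## References
* N. M. Katz, *Crystalline cohomology, Dieudonné modules, and Jacobi sums* (1981), Thm. 5.1.4–5.1.5 (a morphism between the REDUCTIONS
  of two formal groups — here the identity of `Ŵ_D ⊗ 𝒪_D/ϖ = Ê₀ ⊗ 𝒪_D/ϖ` — acts on the lifts). [Katz1981CrystallineDieudonne]
* J. H. Silverman, *The Arithmetic of Elliptic Curves* (2009), IV.2.3 (`[p]` is functorial in the equation), VII.§1–2. [SilvermanAEC2009]
* J.-P. Serre, *Local Fields* (1979), Ch. I §6 Prop. 17–18 (`𝒪_D = ℤ_p[ϖ]`, `‖ϖ‖ < 1`). [SerreLocalFields1979]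
-/

noncomputable section

open PowerSeries Filter Topology Field WittVector ValuativeRel
open scoped Classical

namespace Literature.NumberTheory.PAdicHodge

open Literature.NumberTheory.GaloisRepresentations Literature.NumberTheory.GaloisRepresentations.IsNonarchimedeanLocalField
open Literature.NumberTheory.GaloisRepresentations.LubinTate Literature.NumberTheory.EllipticCurves

variable {F : Type} [Field F] [ValuativeRel F] [TopologicalSpace F] [IsNonarchimedeanLocalField F] [CharZero F]
  {p : ℕ} [hpp : Fact p.Prime] {hp : valuation F p < 1} (D : EisensteinRoot F p hp)
  [Fact (¬ IsUnit (p : integerC F))]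

/-! ## §1 `[p]_{E₀ ⊗ 𝒪_D} = [p]_{E₀}` on `Ŵ(𝔪_{ℂ_F})` -/

omit [Fact (¬ IsUnit (p : integerC F))] in
/-- The structure maps `ℤ → 𝒪_{ℂ_F}` and `ℤ → 𝒪_D → 𝒪_{ℂ_F}` agree. [folklore] -/
private theorem algebraMap_coeffDisc_algebraMap_int (a : ℤ) :
    algebraMap (EisensteinRoot.CoeffDisc D) (CBall F) (algebraMap ℤ (EisensteinRoot.CoeffDisc D) a) = algebraMap ℤ (CBall F) a := by
  rw [algebraMap_int_eq, algebraMap_int_eq, eq_intCast, eq_intCast, map_intCast]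

omit [Fact (¬ IsUnit (p : integerC F))] in
/-- **`[p]_{E₀ ⊗ 𝒪_D}(t) = [p]_{E₀}(t)`** on `Ŵ(𝔪_{ℂ_F})`: the ramified-API multiplication `AinfRamTop.mulPC (E₀.map (ℤ → 𝒪_D))` is the φ-road's
`AinfTop.mulPC F p E₀` (change of coefficients in the evaluation, `[p]` functorial in the equation). [cite: SilvermanAEC2009, IV.2.3] -/
theorem coe_ramified_mulPC_map_int (E₀ : WeierstrassCurve ℤ) (t : (maxNilIdealC F).toIdeal) :
    AinfRamTop.mulPC (D := D) (E₀.map (algebraMap ℤ (EisensteinRoot.CoeffDisc D))) t = AinfTop.mulPC F p E₀ t := by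
  rw [AinfRamTop.mulPC, AinfTop.mulPC]
  have key : ∀ (h₁ h₂ : PowerSeries (EisensteinRoot.CoeffDisc D)) (e : h₁ = h₂) (hh₁ : PowerSeries.constantCoeff h₁ = 0)
      (hh₂ : PowerSeries.constantCoeff h₂ = 0), evalPt₁ (maxNilIdealC F) h₁ hh₁ t = evalPt₁ (maxNilIdealC F) h₂ hh₂ t := by
    intro h₁ h₂ e hh₁ hh₂; subst e; rfl
  have hmap : PowerSeries.constantCoeff ((E₀.formalMul p).map (algebraMap ℤ (EisensteinRoot.CoeffDisc D))) = 0 := by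
    rw [← PowerSeries.coeff_zero_eq_constantCoeff_apply, PowerSeries.coeff_map, PowerSeries.coeff_zero_eq_constantCoeff_apply,
      E₀.constantCoeff_formalMul, map_zero]
  rw [key _ _ (E₀.map_formalMul (algebraMap ℤ (EisensteinRoot.CoeffDisc D)) p).symm _ hmap]
  exact evalPt₁_map_of_algebraMap_eq (algebraMap ℤ (EisensteinRoot.CoeffDisc D)) (algebraMap_coeffDisc_algebraMap_int D)
    (maxNilIdealC F) (E₀.formalMul p) (E₀.constantCoeff_formalMul p) hmap t

/-! ## §2 `[p]_{W₁} ≡ [p]_{W₂} (mod ϖ)` for `W₁ ≡ W₂ (mod ϖ)` -/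

omit hpp in
/-- **Functoriality of `[p]` under reduction**: if two Weierstrass equations over a ring `R` agree modulo an element `c`, their
multiplication-by-`n` series differ by a multiple of `c` (`[n]_{W ⊗ R/c} = [n]_W ⊗ R/c`). [cite: SilvermanAEC2009, IV.2.3] -/
theorem exists_formalMul_sub_eq_C_mul_of_map_eq {R : Type*} [CommRing R] (c : R) (W₁ W₂ : WeierstrassCurve R)
    (h : W₁.map (Ideal.Quotient.mk (Ideal.span {c})) = W₂.map (Ideal.Quotient.mk (Ideal.span {c}))) (n : ℕ) :
    ∃ G : PowerSeries R, W₁.formalMul n - W₂.formalMul n = PowerSeries.C c * G := by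
  have hcoeff : ∀ k, c ∣ PowerSeries.coeff k (W₁.formalMul n - W₂.formalMul n) := fun k => by
    rw [← Ideal.mem_span_singleton, ← Ideal.Quotient.eq_zero_iff_mem, map_sub, map_sub, sub_eq_zero, ← PowerSeries.coeff_map,
      ← PowerSeries.coeff_map, WeierstrassCurve.map_formalMul, WeierstrassCurve.map_formalMul, h]
  refine ⟨PowerSeries.mk fun k => Classical.choose (hcoeff k), PowerSeries.ext fun k => ?_⟩
  rw [PowerSeries.coeff_C_mul, PowerSeries.coeff_mk]
  exact Classical.choose_spec (hcoeff k)

omit [Fact (¬ IsUnit (p : integerC F))] in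
/-- `‖(c·G)(t)‖ ≤ ‖c‖` for `G ∈ 𝒪_D⟦X⟧`, `t ∈ 𝔪_ℂ` (values of `G` lie in `𝒪_ℂ`). [cite: CasselsFrohlichANT1967, Ch. VI §3.2] -/
theorem norm_evalAt_C_mul_le (c : EisensteinRoot.CoeffDisc D) (G : PowerSeries (EisensteinRoot.CoeffDisc D)) (t : (maxNilIdealC F).toIdeal) :
    ‖((evalAt (maxNilIdealC F) t (PowerSeries.C c * G) : CBall F) : CompletedAlgClosure F)‖ ≤
      ‖((algebraMap (EisensteinRoot.CoeffDisc D) (CBall F) c : CBall F) : CompletedAlgClosure F)‖ := by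
  rw [map_mul, show (PowerSeries.C c : PowerSeries (EisensteinRoot.CoeffDisc D)) = algebraMap _ _ c from rfl, AlgHom.commutes,
    Subring.coe_mul, norm_mul]
  exact mul_le_of_le_one_right (norm_nonneg _) ((mem_unitBall_iff _).mp (evalAt (maxNilIdealC F) t G).2)

omit [Fact (¬ IsUnit (p : integerC F))] in
/-- ★ **`‖[p]_{W₁}(t) − [p]_{W₂}(t)‖ ≤ ‖c‖`** on `Ŵ(𝔪_{ℂ_F})` for Weierstrass equations `W₁ ≡ W₂ (mod c)` over `𝒪_D`.
[cite: SilvermanAEC2009, IV.2.3] [cite: Katz1981CrystallineDieudonne, Thm. 5.1.4] -/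
theorem norm_ramified_mulPC_sub_le (c : EisensteinRoot.CoeffDisc D) (W₁ W₂ : WeierstrassCurve (EisensteinRoot.CoeffDisc D))
    (h : W₁.map (Ideal.Quotient.mk (Ideal.span {c})) = W₂.map (Ideal.Quotient.mk (Ideal.span {c}))) (t : (maxNilIdealC F).toIdeal) :
    ‖(((AinfRamTop.mulPC (D := D) W₁ t : (maxNilIdealC F).toIdeal) : CBall F) : CompletedAlgClosure F) -
        (((AinfRamTop.mulPC (D := D) W₂ t : (maxNilIdealC F).toIdeal) : CBall F) : CompletedAlgClosure F)‖ ≤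
      ‖((algebraMap (EisensteinRoot.CoeffDisc D) (CBall F) c : CBall F) : CompletedAlgClosure F)‖ := by
  obtain ⟨G, hG⟩ := exists_formalMul_sub_eq_C_mul_of_map_eq c W₁ W₂ h p
  rw [AinfRamTop.mulPC, AinfRamTop.mulPC, coe_evalPt₁_eq_evalAt, coe_evalPt₁_eq_evalAt, ← AddSubgroupClass.coe_sub, ← map_sub, hG]
  exact norm_evalAt_C_mul_le D c G t

/-! ## §3 Division sequences of `W_D` are approximate `[p]_{E₀}`-division sequences; the CM-fibre transport -/

omit [Fact (¬ IsUnit (p : integerC F))] in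
/-- ★★ **A `[p]_{W_D}`-division sequence is an APPROXIMATE `[p]_{E₀}`-division sequence**: if `W_D ≡ E₀ ⊗ 𝒪_D (mod ϖ)` then
`‖[p]_{E₀}(v_{n+1}) − v_n‖ ≤ ‖ϖ‖` for every exact `[p]_{W_D}`-division sequence `v` of `Ŵ_D(𝔪_ℂ)` (`ϖ` the root of the Eisenstein datum,
`‖ϖ‖ < 1`). [cite: Katz1981CrystallineDieudonne, Thm. 5.1.4] [cite: SilvermanAEC2009, IV.2.3] -/
theorem norm_mulPC_int_sub_le_of_divisionSeq (W : WeierstrassCurve (EisensteinRoot.CoeffDisc D)) (E₀ : WeierstrassCurve ℤ)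
    (hWE : W.map (Ideal.Quotient.mk (Ideal.span {EisensteinRoot.CoeffDisc.of D (AdjoinRoot.root D.poly)})) =
      (E₀.map (algebraMap ℤ (EisensteinRoot.CoeffDisc D))).map
        (Ideal.Quotient.mk (Ideal.span {EisensteinRoot.CoeffDisc.of D (AdjoinRoot.root D.poly)})))
    {v : ℕ → (maxNilIdealC F).toIdeal} (hv : ∀ n, AinfRamTop.mulPC (D := D) W (v (n + 1)) = v n) (n : ℕ) :
    ‖(((AinfTop.mulPC F p E₀ (v (n + 1)) : (maxNilIdealC F).toIdeal) : CBall F) : CompletedAlgClosure F) -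
        (((v n : (maxNilIdealC F).toIdeal) : CBall F) : CompletedAlgClosure F)‖ ≤
      ‖((D.rootC : integerC F) : CompletedAlgClosure F)‖ := by
  have h1 := norm_ramified_mulPC_sub_le D _ W _ hWE (v (n + 1))
  rw [coe_ramified_mulPC_map_int D E₀, hv n, ← norm_neg, neg_sub] at h1
  refine h1.trans (le_of_eq ?_)
  rw [EisensteinRoot.coe_algebraMap_coeffDisc_cBall, EisensteinRoot.Coeff.toF_root, EisensteinRoot.coe_rootC]

/-- ★★★ **THE CM-FIBRE TRANSPORT**: for a ramified good model `W_D ≡ E₀ ⊗ 𝒪_D (mod ϖ)` with `E₀/ℤ`, every exact `[p]_{W_D}`-division sequence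
`v` of `Ŵ_D(𝔪_{ℂ_F})` admits a UNIQUE exact `[p]_{E₀}`-division sequence `w` of `Ê₀(𝔪_{ℂ_F})` (`AinfTop.mulPC F p E₀ (w (n+1)) = w n` — the
hypothesis of the φ-road's towers) with `‖w_n − v_n‖ ≤ ‖ϖ‖` for all `n`. (Additive and `Γ_F`-equivariant in `v`:
`AinfTop.addSeq_eq_of_divisionSeq_norm_sub_le`, `AinfTop.galSeq_eq_of_divisionSeq_norm_sub_le`.)
[cite: Katz1981CrystallineDieudonne, Thm. 5.1.4–5.1.5] [cite: Colmez1992PeriodesAbeliennes, §2] -/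
theorem exists_unique_int_divisionSeq_of_ramified (W : WeierstrassCurve (EisensteinRoot.CoeffDisc D)) (E₀ : WeierstrassCurve ℤ)
    (hWE : W.map (Ideal.Quotient.mk (Ideal.span {EisensteinRoot.CoeffDisc.of D (AdjoinRoot.root D.poly)})) =
      (E₀.map (algebraMap ℤ (EisensteinRoot.CoeffDisc D))).map
        (Ideal.Quotient.mk (Ideal.span {EisensteinRoot.CoeffDisc.of D (AdjoinRoot.root D.poly)})))
    {v : ℕ → (maxNilIdealC F).toIdeal} (hv : ∀ n, AinfRamTop.mulPC (D := D) W (v (n + 1)) = v n) :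
    ∃! w : ℕ → (maxNilIdealC F).toIdeal, (∀ n, AinfTop.mulPC F p E₀ (w (n + 1)) = w n) ∧
      ∀ n, ‖(((w n : (maxNilIdealC F).toIdeal) : CBall F) : CompletedAlgClosure F) -
        (((v n : (maxNilIdealC F).toIdeal) : CBall F) : CompletedAlgClosure F)‖ ≤ ‖((D.rootC : integerC F) : CompletedAlgClosure F)‖ := by
  obtain ⟨w, hw, hwv⟩ := AinfTop.exists_mulPC_divisionSeq_norm_sub_le E₀ D.norm_rootC_lt_one v
    (norm_mulPC_int_sub_le_of_divisionSeq D W E₀ hWE hv)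
  refine ⟨w, ⟨hw, hwv⟩, fun w' hw' => AinfTop.mulPC_divisionSeq_unique E₀ D.norm_rootC_lt_one w' w hw'.1 hw fun n => ?_⟩
  have hsplit : ∀ a b c : CompletedAlgClosure F, a - c = (a - b) + (b - c) := fun a b c => by ring
  rw [hsplit _ (((v n : (maxNilIdealC F).toIdeal) : CBall F) : CompletedAlgClosure F)]
  refine (IsUltrametricDist.norm_add_le_max _ _).trans (max_le (hw'.2 n) ?_)
  rw [← norm_neg, neg_sub]
  exact hwv n

/-! ## §4 The K★ cells: the explicit models `⟨0,0,0, a·ϖ^{r₄}, b·ϖ^{r₆}⟩` over `𝒪_D` are congruent mod `ϖ` to the `ℤ`-curves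
`⟨0,0,0, a·[r₄ = 0], b·[r₆ = 0]⟩` (the CM fibres `y² = x³ + b`, `y² = x³ + a·x`) -/

omit [Fact (¬ IsUnit (p : integerC F))] in
/-- ★ **The cells' congruence `W_D ≡ E₀ (mod ϖ)`**: for integers `a, b` and exponents `r₄, r₆`, the explicit `𝒪_D`-model
`W_D = ⟨0, 0, 0, a·ϖ^{r₄}, b·ϖ^{r₆}⟩` (tree `DeRhamSupersingularRamifiedCells`: `(p; e, r₄, r₆) ∈ {(5;3,1,0), (5;6,4,0), (7;4,0,2)}` for the
K★ types `(5; IV*)`, `(5; II*)`, `(7; III*)`) and the `ℤ`-curve `E₀ = ⟨0, 0, 0, a·[r₄ = 0], b·[r₆ = 0]⟩` have the same reduction modulo `ϖ`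
(`ϖ^r ≡ 0` for `r > 0`). This is the hypothesis `hWE` of `exists_unique_int_divisionSeq_of_ramified`. [cite: SilvermanAEC2009, VII.§1] -/
theorem map_explicitModel_eq_map_cmFibre (a b : ℤ) (r₄ r₆ : ℕ) :
    (⟨0, 0, 0, algebraMap ℤ (EisensteinRoot.CoeffDisc D) a * EisensteinRoot.CoeffDisc.of D (AdjoinRoot.root D.poly) ^ r₄,
        algebraMap ℤ (EisensteinRoot.CoeffDisc D) b * EisensteinRoot.CoeffDisc.of D (AdjoinRoot.root D.poly) ^ r₆⟩ :
        WeierstrassCurve (EisensteinRoot.CoeffDisc D)).map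
      (Ideal.Quotient.mk (Ideal.span {EisensteinRoot.CoeffDisc.of D (AdjoinRoot.root D.poly)})) =
    ((⟨0, 0, 0, if r₄ = 0 then a else 0, if r₆ = 0 then b else 0⟩ : WeierstrassCurve ℤ).map
        (algebraMap ℤ (EisensteinRoot.CoeffDisc D))).map
      (Ideal.Quotient.mk (Ideal.span {EisensteinRoot.CoeffDisc.of D (AdjoinRoot.root D.poly)})) := by
  set ϱ := EisensteinRoot.CoeffDisc.of D (AdjoinRoot.root D.poly) with hϱ
  set π := Ideal.Quotient.mk (Ideal.span {ϱ}) with hπ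
  have hπϱ : π ϱ = 0 := Ideal.Quotient.eq_zero_iff_mem.2 (Ideal.mem_span_singleton_self _)
  have hpow : ∀ (c : ℤ) (r : ℕ), π ((c : EisensteinRoot.CoeffDisc D) * ϱ ^ r) =
      π ((if r = 0 then c else 0 : ℤ) : EisensteinRoot.CoeffDisc D) := fun c r => by
    rcases Nat.eq_zero_or_pos r with rfl | hr
    · rw [pow_zero, mul_one, if_pos rfl]
    · rw [map_mul, map_pow, hπϱ, zero_pow hr.ne', mul_zero, if_neg hr.ne', Int.cast_zero, map_zero]
  ext <;> simp only [WeierstrassCurve.map_a₁, WeierstrassCurve.map_a₂, WeierstrassCurve.map_a₃, WeierstrassCurve.map_a₄,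
    WeierstrassCurve.map_a₆, map_zero, eq_intCast, hpow]

end Literature.NumberTheory.PAdicHodge
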